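import Summits.AtomisticToContinuum.Crystallization.Theorems.ExcessDecayLiouvilleTranslation
import Summits.AtomisticToContinuum.Crystallization.Theorems.ExcessDecayLiouvilleCaccioppoli

/-!
# Route `ExcessDecayLiouville`: difference quotients of displacements

Bookkeeping for step (c2), `k ≥ 2`, of the energy route for item `ExcessDecay` (stmt-AtomisticToContinuum-9334): for a
finitely supported, bounded displacement `h` and a lattice vector `τ ∈ Λ₀`, the difference quotient
`D_τ h := x ↦ h (x + Aτ) − h x` is finitely supported (`finite_support_translate_sub`), bounded by `2B`
(`norm_translate_sub_le`), and the linearised operator commutes with `D_τ`: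
`(L (D_τ h))(p) = (L h)(p + Aτ) − (L h)(p)` at every site `p` (`opRow_translate_sub`, from `opRow_diff` with the row
summabilities discharged by boundedness).  Hence the work term of `gradient_estimate_local` for `D_τ h` is controlled by
the residual `L h` at `p` and `p + Aτ`:
`|Σ' η_p² ⟪(L D_τ h)(p), D_τ h p⟫| ≤ Σ'_p η_p² (‖(Lh)(p + Aτ)‖ + ‖(Lh)(p)‖) · ‖D_τ h p‖` (`abs_work_translate_sub_le`).
All `[folklore]`; helper lemmas, nothing here closes an item.
-/

noncomputable section

namespace Summit.AtomisticToContinuum.Crystallization.Theorems.ExcessDecayLiouville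

open scoped BigOperators Topology InnerProductSpace RealInnerProductSpace Classical
open Literature.MathematicalPhysics.StatisticalMechanics
open Summit.AtomisticToContinuum.Crystallization.Theorems.PhononStabilityNegative

section

variable {t : Fin 2 → (EuclideanSpace ℝ (Fin 3))} {A : (EuclideanSpace ℝ (Fin 3)) →L[ℝ] (EuclideanSpace ℝ (Fin 3))}

/-- The translate `x ↦ h (x + Aτ)` of a finitely supported displacement is finitely supported. [folklore] -/
theorem finite_support_translate {h : (EuclideanSpace ℝ (Fin 3)) → (EuclideanSpace ℝ (Fin 3))} (hh : (Function.support h).Finite) (w : (EuclideanSpace ℝ (Fin 3))) :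
    (Function.support fun x : (EuclideanSpace ℝ (Fin 3)) => h (x + w)).Finite := by
  have : (Function.support fun x : (EuclideanSpace ℝ (Fin 3)) => h (x + w)) = (fun y => y - w) '' Function.support h := by
    ext x
    simp only [Function.mem_support, ne_eq, Set.mem_image]
    constructor
    · intro hx
      exact ⟨x + w, hx, by abel⟩
    · rintro ⟨y, hy, rfl⟩
      simpa using hy
  rw [this]
  exact hh.image _

/-- The difference quotient `D_τ h = h(· + Aτ) − h` of a finitely supported displacement is finitely supported.
[folklore] -/
theorem finite_support_translate_sub {h : (EuclideanSpace ℝ (Fin 3)) → (EuclideanSpace ℝ (Fin 3))} (hh : (Function.support h).Finite) (w : (EuclideanSpace ℝ (Fin 3))) :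
    (Function.support fun x : (EuclideanSpace ℝ (Fin 3)) => h (x + w) - h x).Finite := by
  refine ((finite_support_translate hh w).union hh).subset fun x hx => ?_
  by_contra hcon
  simp only [Set.mem_union, Function.mem_support, ne_eq, not_or, not_not] at hcon
  apply hx
  simp [hcon.1, hcon.2]

/-- `‖D_τ h‖ ≤ 2B` when `‖h‖ ≤ B`. [folklore] -/
theorem norm_translate_sub_le {h : (EuclideanSpace ℝ (Fin 3)) → (EuclideanSpace ℝ (Fin 3))} {B : ℝ} (hB : ∀ x, ‖h x‖ ≤ B) (w x : (EuclideanSpace ℝ (Fin 3))) :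
    ‖h (x + w) - h x‖ ≤ 2 * B := by
  have := norm_sub_le (h (x + w)) (h x)
  linarith [hB (x + w), hB x]

/-- **The operator commutes with difference quotients**: `(L (D_τ h))(p) = (L h)(p + Aτ) − (L h)(p)` for bounded `h`
and `τ ∈ Λ₀`. [folklore] -/
theorem opRow_translate_sub (hA : Adm₀ A) (hI : Inner₀ t A) {h : (EuclideanSpace ℝ (Fin 3)) → (EuclideanSpace ℝ (Fin 3))} {B : ℝ} (hB : ∀ x, ‖h x‖ ≤ B)
    {τ : (EuclideanSpace ℝ (Fin 3))} (hτ : τ ∈ Λ₀) (p : Sites₀ t A) :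
    (∑' q : Sites₀ t A, (if (p : (EuclideanSpace ℝ (Fin 3))) ≠ q then ((-((‖(p : (EuclideanSpace ℝ (Fin 3))) - q‖ ^ 2)⁻¹) ^ 7 + ((‖(p : (EuclideanSpace ℝ (Fin 3))) - q‖ ^ 2)⁻¹) ^ 4) • ((h ((p : (EuclideanSpace ℝ (Fin 3))) + A τ) - h p) - (h ((q : (EuclideanSpace ℝ (Fin 3))) + A τ) - h q)) + (2 * ⟪(p : (EuclideanSpace ℝ (Fin 3))) - q, (h ((p : (EuclideanSpace ℝ (Fin 3))) + A τ) - h p) - (h ((q : (EuclideanSpace ℝ (Fin 3))) + A τ) - h q)⟫ * (7 * ((‖(p : (EuclideanSpace ℝ (Fin 3))) - q‖ ^ 2)⁻¹) ^ 8 - 4 * ((‖(p : (EuclideanSpace ℝ (Fin 3))) - q‖ ^ 2)⁻¹) ^ 5)) • ((p : (EuclideanSpace ℝ (Fin 3))) - q)) else 0)) = (∑' q : Sites₀ t A, (if (p : (EuclideanSpace ℝ (Fin 3))) + A τ ≠ q then ((-((‖(p : (EuclideanSpace ℝ (Fin 3))) + A τ - q‖ ^ 2)⁻¹) ^ 7 +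 ((‖(p : (EuclideanSpace ℝ (Fin 3))) + A τ - q‖ ^ 2)⁻¹) ^ 4) • (h ((p : (EuclideanSpace ℝ (Fin 3))) + A τ) - h q) + (2 * ⟪(p : (EuclideanSpace ℝ (Fin 3))) + A τ - q, h ((p : (EuclideanSpace ℝ (Fin 3))) + A τ) - h q⟫ * (7 * ((‖(p : (EuclideanSpace ℝ (Fin 3))) + A τ - q‖ ^ 2)⁻¹) ^ 8 - 4 * ((‖(p : (EuclideanSpace ℝ (Fin 3))) + A τ - q‖ ^ 2)⁻¹) ^ 5)) • ((p : (EuclideanSpace ℝ (Fin 3))) + A τ - q)) else 0)) - ∑' q : Sites₀ t A, (if (p : (EuclideanSpace ℝ (Fin 3))) ≠ q then ((-((‖(p : (EuclideanSpace ℝ (Fin 3))) - q‖ ^ 2)⁻¹) ^ 7 + ((‖(p : (EuclideanSpace ℝ (Fin 3))) - q‖ ^ 2)⁻¹) ^ 4) • (h p - h q) + (2 * ⟪(p : (EuclideanSpace ℝ (Fin 3))) - q, h p - h q⟫ * (7 * ((‖(p : (EuclideanSpace ℝ (Fin 3))) - q‖ ^ 2)⁻¹) ^ 8 - 4 * ((‖(p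 : (EuclideanSpace ℝ (Fin 3))) - q‖ ^ 2)⁻¹) ^ 5)) • ((p : (EuclideanSpace ℝ (Fin 3))) - q)) else 0) := by
  have h1 : Summable (fun q : Sites₀ t A => (if (p : (EuclideanSpace ℝ (Fin 3))) ≠ q then ((-((‖(p : (EuclideanSpace ℝ (Fin 3))) - q‖ ^ 2)⁻¹) ^ 7 + ((‖(p : (EuclideanSpace ℝ (Fin 3))) - q‖ ^ 2)⁻¹) ^ 4) • (h ((p : (EuclideanSpace ℝ (Fin 3))) + A τ) - h ((q : (EuclideanSpace ℝ (Fin 3))) + A τ)) + (2 * ⟪(p : (EuclideanSpace ℝ (Fin 3))) - q, h ((p : (EuclideanSpace ℝ (Fin 3))) + A τ) - h ((q : (EuclideanSpace ℝ (Fin 3))) + A τ)⟫ * (7 * ((‖(p : (EuclideanSpace ℝ (Fin 3))) - q‖ ^ 2)⁻¹) ^ 8 - 4 * ((‖(p : (EuclideanSpace ℝ (Fin 3))) - q‖ ^ 2)⁻¹) ^ 5)) • ((p : (EuclideanSpace ℝ (Fin 3))) - q)) else 0)) :=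
    summable_opRow_of_bounded hA hI (h := fun x => h (x + A τ)) (fun x => hB (x + A τ)) p
  have h2 : Summable (fun q : Sites₀ t A => (if (p : (EuclideanSpace ℝ (Fin 3))) ≠ q then ((-((‖(p : (EuclideanSpace ℝ (Fin 3))) - q‖ ^ 2)⁻¹) ^ 7 + ((‖(p : (EuclideanSpace ℝ (Fin 3))) - q‖ ^ 2)⁻¹) ^ 4) • (h p - h q) + (2 * ⟪(p : (EuclideanSpace ℝ (Fin 3))) - q, h p - h q⟫ * (7 * ((‖(p : (EuclideanSpace ℝ (Fin 3))) - q‖ ^ 2)⁻¹) ^ 8 - 4 * ((‖(p : (EuclideanSpace ℝ (Fin 3))) - q‖ ^ 2)⁻¹) ^ 5)) • ((p : (EuclideanSpace ℝ (Fin 3))) - q)) else 0)) := summable_opRow_of_bounded hA hI hB p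
  exact opRow_diff h hτ p h1 h2

/-- **Work term of a difference quotient**: with `g = D_τ h`,
`|Σ' η_p² ⟪(L g)(p), g p⟫| ≤ Σ'_p η_p² (‖(Lh)(p+Aτ)‖ + ‖(Lh)(p)‖) ‖g p‖`, the right-hand side being a finite sum in
disguise (`η` finitely supported). [folklore] -/
theorem abs_work_translate_sub_le (hA : Adm₀ A) (hI : Inner₀ t A) {h : (EuclideanSpace ℝ (Fin 3)) → (EuclideanSpace ℝ (Fin 3))} {B : ℝ} (hB : ∀ x, ‖h x‖ ≤ B)
    {τ : (EuclideanSpace ℝ (Fin 3))} (hτ : τ ∈ Λ₀) {η : (EuclideanSpace ℝ (Fin 3)) → ℝ} (hη : (Function.support η).Finite) :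
    |∑' p : Sites₀ t A, (η p) ^ 2 * ⟪∑' q : Sites₀ t A, (if (p : (EuclideanSpace ℝ (Fin 3))) ≠ q then ((-((‖(p : (EuclideanSpace ℝ (Fin 3))) - q‖ ^ 2)⁻¹) ^ 7 + ((‖(p : (EuclideanSpace ℝ (Fin 3))) - q‖ ^ 2)⁻¹) ^ 4) • ((h ((p : (EuclideanSpace ℝ (Fin 3))) + A τ) - h p) - (h ((q : (EuclideanSpace ℝ (Fin 3))) + A τ) - h q)) + (2 * ⟪(p : (EuclideanSpace ℝ (Fin 3))) - q, (h ((p : (EuclideanSpace ℝ (Fin 3))) + A τ) - h p) - (h ((q : (EuclideanSpace ℝ (Fin 3))) + A τ) - h q)⟫ * (7 * ((‖(p : (EuclideanSpace ℝ (Fin 3))) - q‖ ^ 2)⁻¹) ^ 8 - 4 * ((‖(p : (EuclideanSpace ℝ (Fin 3))) - q‖ ^ 2)⁻¹) ^ 5)) • ((p : (EuclideanSpace ℝ (Fin 3))) - q)) else 0), h ((p : (EuclideanSpace ℝ (Fin 3))) + A τ) - h p⟫| ≤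
      ∑' p : Sites₀ t A, (η p) ^ 2 *
        ((‖∑' q : Sites₀ t A, (if (p : (EuclideanSpace ℝ (Fin 3))) + A τ ≠ q then ((-((‖(p : (EuclideanSpace ℝ (Fin 3))) + A τ - q‖ ^ 2)⁻¹) ^ 7 + ((‖(p : (EuclideanSpace ℝ (Fin 3))) + A τ - q‖ ^ 2)⁻¹) ^ 4) • (h ((p : (EuclideanSpace ℝ (Fin 3))) + A τ) - h q) + (2 * ⟪(p : (EuclideanSpace ℝ (Fin 3))) + A τ - q, h ((p : (EuclideanSpace ℝ (Fin 3))) + A τ) - h q⟫ * (7 * ((‖(p : (EuclideanSpace ℝ (Fin 3))) + A τ - q‖ ^ 2)⁻¹) ^ 8 - 4 * ((‖(p : (EuclideanSpace ℝ (Fin 3))) + A τ - q‖ ^ 2)⁻¹) ^ 5)) • ((p : (EuclideanSpace ℝ (Fin 3))) + A τ - q)) else 0)‖ + ‖∑' q : Sites₀ t A, (if (p : (EuclideanSpace ℝ (Fin 3))) ≠ q then ((-((‖(p : (EuclideanSpace ℝ (Fin 3))) - q‖ ^ 2)⁻¹) ^ 7 + ((‖(p : (EuclideanSpace ℝ (Fin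 3))) - q‖ ^ 2)⁻¹) ^ 4) • (h p - h q) + (2 * ⟪(p : (EuclideanSpace ℝ (Fin 3))) - q, h p - h q⟫ * (7 * ((‖(p : (EuclideanSpace ℝ (Fin 3))) - q‖ ^ 2)⁻¹) ^ 8 - 4 * ((‖(p : (EuclideanSpace ℝ (Fin 3))) - q‖ ^ 2)⁻¹) ^ 5)) • ((p : (EuclideanSpace ℝ (Fin 3))) - q)) else 0)‖) * ‖h ((p : (EuclideanSpace ℝ (Fin 3))) + A τ) - h p‖) := by
  classical
  -- both families vanish off the (finite) support of η on the sites
  have hfin : (Subtype.val ⁻¹' Function.support η : Set (Sites₀ t A)).Finite :=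
    hη.preimage Subtype.val_injective.injOn
  set T := hfin.toFinset with hT
  have hTm : ∀ p : Sites₀ t A, p ∉ T → η p = 0 := by
    intro p hp
    by_contra h'
    exact hp ((Set.Finite.mem_toFinset _).2 h')
  have hL : ∀ p : Sites₀ t A, p ∉ T → (η p) ^ 2 * ⟪∑' q : Sites₀ t A, (if (p : (EuclideanSpace ℝ (Fin 3))) ≠ q then ((-((‖(p : (EuclideanSpace ℝ (Fin 3))) - q‖ ^ 2)⁻¹) ^ 7 + ((‖(p : (EuclideanSpace ℝ (Fin 3))) - q‖ ^ 2)⁻¹) ^ 4) • ((h ((p : (EuclideanSpace ℝ (Fin 3))) + A τ) - h p) - (h ((q : (EuclideanSpace ℝ (Fin 3))) + A τ) - h q)) + (2 * ⟪(p : (EuclideanSpace ℝ (Fin 3))) - q, (h ((p : (EuclideanSpace ℝ (Fin 3))) + A τ) - h p) - (h ((q : (EuclideanSpace ℝ (Fin 3))) + A τ) - h q)⟫ * (7 * ((‖(p : (EuclideanSpace ℝ (Fin 3))) - q‖ ^ 2)⁻¹) ^ 8 - 4 * ((‖(p : (EuclideanSpace ℝ (Fin 3))) - q‖ ^ 2)⁻¹)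 ^ 5)) • ((p : (EuclideanSpace ℝ (Fin 3))) - q)) else 0), h ((p : (EuclideanSpace ℝ (Fin 3))) + A τ) - h p⟫ = 0 := by
    intro p hp; rw [hTm p hp]; ring
  have hR : ∀ p : Sites₀ t A, p ∉ T → (η p) ^ 2 *
      ((‖∑' q : Sites₀ t A, (if (p : (EuclideanSpace ℝ (Fin 3))) + A τ ≠ q then ((-((‖(p : (EuclideanSpace ℝ (Fin 3))) + A τ - q‖ ^ 2)⁻¹) ^ 7 + ((‖(p : (EuclideanSpace ℝ (Fin 3))) + A τ - q‖ ^ 2)⁻¹) ^ 4) • (h ((p : (EuclideanSpace ℝ (Fin 3))) + A τ) - h q) + (2 * ⟪(p : (EuclideanSpace ℝ (Fin 3))) + A τ - q, h ((p : (EuclideanSpace ℝ (Fin 3))) + A τ) - h q⟫ * (7 * ((‖(p : (EuclideanSpace ℝ (Fin 3))) + A τ - q‖ ^ 2)⁻¹) ^ 8 - 4 * ((‖(p : (EuclideanSpace ℝ (Fin 3))) + A τ - q‖ ^ 2)⁻¹) ^ 5)) • ((p : (EuclideanSpace ℝ (Fin 3))) + A τ - q)) else 0)‖ + ‖∑' q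 : Sites₀ t A, (if (p : (EuclideanSpace ℝ (Fin 3))) ≠ q then ((-((‖(p : (EuclideanSpace ℝ (Fin 3))) - q‖ ^ 2)⁻¹) ^ 7 + ((‖(p : (EuclideanSpace ℝ (Fin 3))) - q‖ ^ 2)⁻¹) ^ 4) • (h p - h q) + (2 * ⟪(p : (EuclideanSpace ℝ (Fin 3))) - q, h p - h q⟫ * (7 * ((‖(p : (EuclideanSpace ℝ (Fin 3))) - q‖ ^ 2)⁻¹) ^ 8 - 4 * ((‖(p : (EuclideanSpace ℝ (Fin 3))) - q‖ ^ 2)⁻¹) ^ 5)) • ((p : (EuclideanSpace ℝ (Fin 3))) - q)) else 0)‖) * ‖h ((p : (EuclideanSpace ℝ (Fin 3))) + A τ) - h p‖) = 0 := by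
    intro p hp; rw [hTm p hp]; ring
  rw [tsum_eq_sum hL, tsum_eq_sum hR]
  refine (Finset.abs_sum_le_sum_abs _ _).trans (Finset.sum_le_sum fun p _ => ?_)
  rw [abs_mul, abs_pow, sq_abs, opRow_translate_sub hA hI hB hτ p]
  refine mul_le_mul_of_nonneg_left ?_ (sq_nonneg _)
  refine (abs_real_inner_le_norm _ _).trans ?_
  exact mul_le_mul_of_nonneg_right (norm_sub_le _ _) (norm_nonneg _)

end

end Summit.AtomisticToContinuum.Crystallization.Theorems.ExcessDecayLiouville

end
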